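import Summits.Langlands.Langlands.Theses.ParityBlindBianchi
import Summits.Langlands.Langlands.Theorems.ParityBlindBianchiArtinWeightRealisationEvenRealisationOfEventually
import HarnessLib

/-!
# Monotonicity of the open stub S1 of the line `SketchIdeator2` (crux `ParityBlindBianchi.ArtinWeightRealisationEven`,
# item stmt-Langlands-16619): S1 (v4) ⇒ S1ae (v5) ⇒ S1ad (v6)

Helper file (`--supports stmt-Langlands-16619`, registered sub-goals `signBlindAE_of_signBlindGood` and
`adCompatibleAE_of_signBlindAE`).  Each reshape of the line WEAKENED its open automorphic stub, kernel-checked: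

* `signBlindAE_of_signBlindGood` — (pointwise in `K, p, ι, σ, S₀`) v4's S1 (sign-blind compatibility at EVERY good place, with `σ` unramified there)
  implies v5's S1ae (sign-blind compatibility at all but finitely many places): the good places of a finite `S₀ ∌ 0` are
  cofinite (`eventually_good`, p162941).
* `adCompatibleAE_of_signBlindAE` — (pointwise) S1ae implies v6's S1ad (compatibility up to a scalar `c ∈ ℂˣ` at all but
  finitely many places): `c = 1`, resp. `c = -1`, the flip `P(-X)` of the degree-two arithmetic-Frobenius polynomial of
  `α` being that of `-α` (`arithFrobPolyOfSatake_comp_neg_X`).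

No definition, no named fact.
-/

-- the line's namespace `Summit.Langlands.Langlands.…` (summit = problem = `Langlands`) repeats a
-- component by design
set_option linter.dupNamespace false

namespace Summit.Langlands.Langlands.Theorems.ArtinWeightRealisationEven

open scoped MatrixGroups Matrix Polynomial NumberField
open NumberField IsDedekindDomain Polynomial Field Filter
open Literature.NumberTheory.Automorphic Literature.NumberTheory.GaloisRepresentations

/-- For a multiset `α` of two complex numbers, the flip `P(-X)` of the arithmetic-Frobenius polynomial
`P = ∏_{a ∈ α} (X - ι⁻¹(a⁻¹))` is the arithmetic-Frobenius polynomial of `-α = α.map ((-1) * ·)`: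
`(-X - u)(-X - v) = (X + u)(X + v)` and `ι⁻¹((-a)⁻¹) = -ι⁻¹(a⁻¹)`. -/
theorem arithFrobPolyOfSatake_comp_neg_X {p : ℕ} [Fact p.Prime] (ι : PadicAlgCl p ≃+* ℂ) (q : ℕ)
    (α : Multiset ℂ) (hα : Multiset.card α = 2) :
    (arithFrobPolyOfSatake ι q 1 α).comp (-X) = arithFrobPolyOfSatake ι q 1 (α.map ((-1 : ℂ) * ·)) := by
  obtain ⟨u, v, rfl⟩ := Multiset.card_eq_two.mp hα
  have h1 : ι.symm (-1 : ℂ)⁻¹ = -1 := by rw [inv_neg, inv_one, map_neg, map_one]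
  rw [ArtinWeightRealisationLevel.arithFrobPolyOfSatake_one_map_mul,
    ArtinWeightRealisationLevel.arithFrobPolyOfSatake_one_eq_prod_map, h1]
  simp only [Multiset.insert_eq_cons, Multiset.map_cons, Multiset.map_singleton, Multiset.prod_cons,
    Multiset.prod_singleton, mul_comp, sub_comp, X_comp, C_comp, neg_mul, one_mul, C_neg]
  ring

/-- **S1 (v4) ⇒ S1ae (v5), pointwise.**  Sign-blind compatibility at every good place (of a finite `S₀ ∌ 0`) implies
sign-blind compatibility at all but finitely many places (the good places are cofinite, `eventually_good`). -/
theorem signBlindAE_of_signBlindGood :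
    ∀ (K : Type) [Field K] [NumberField K] (p : ℕ) [Fact p.Prime] (ι : PadicAlgCl p ≃+* ℂ) (σ : FramedGaloisRep K (PadicAlgCl p) 2) (S₀ : Finset ℕ), (0 : ℕ) ∉ S₀ → (∃ (hcpt : isCompact_glFiniteIntegralLevel 2 K) (π : CuspidalAutomorphicRepData 2 K hcpt), (∃ T : InfinityType K 2, π.1.HasInfinityType T ∧ ∀ τ : K →+* ℂ, ∀ x ∈ T τ, x.a = 0 ∧ x.b = 0) ∧ ∀ w : HeightOneSpectrum (𝓞 K), (∀ ℓ ∈ S₀, ((ℓ : ℕ) : 𝓞 K) ∉ w.asIdeal) → ∃ α : Multiset ℂ, π.1.HasSatakeParamAt w α ∧ σ.IsUnramifiedAt w ∧ (σ.HasFrobCharpolyAt w (arithFrobPolyOfSatake ι w.residueCard 1 α) ∨ σ.HasFrobCharpolyAt w ((arithFrobPolyOfSatake ι w.residueCard 1 α).comp (-X)))) → (∃ (hcpt : isCompact_glFiniteIntegralLevel 2 K) (π : CuspidalAutomorphicRepData 2 K hcpt), (∃ T : InfinityType K 2, π.1.HasInfinityType T ∧ ∀ τ : K →+* ℂ, ∀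 x ∈ T τ, x.a = 0 ∧ x.b = 0) ∧ ∀ᶠ w : HeightOneSpectrum (𝓞 K) in Filter.cofinite, ∃ α : Multiset ℂ, π.1.HasSatakeParamAt w α ∧ (σ.HasFrobCharpolyAt w (arithFrobPolyOfSatake ι w.residueCard 1 α) ∨ σ.HasFrobCharpolyAt w ((arithFrobPolyOfSatake ι w.residueCard 1 α).comp (-X)))) := by
  intro K _ _ p _ ι σ S₀ h0S₀ h
  obtain ⟨hcpt, π, hAT, hπ⟩ := h
  refine ⟨hcpt, π, hAT, (eventually_good K S₀ h0S₀).mono fun w hw => ?_⟩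
  obtain ⟨α, hα, -, hor⟩ := hπ w hw
  exact ⟨α, hα, hor⟩

/-- **S1ae (v5) ⇒ S1ad (v6), pointwise.**  Sign-blind compatibility (`charpoly σ(Frob_w) = P_w(X)` or `P_w(-X)`) is
compatibility up to the scalar `c = 1`, resp. `c = -1` (`arithFrobPolyOfSatake_comp_neg_X`; the Satake parameter has two
entries, `HasSatakeParamAt.card_eq`). -/
theorem adCompatibleAE_of_signBlindAE :
    ∀ (K : Type) [Field K] [NumberField K] (p : ℕ) [Fact p.Prime] (ι : PadicAlgCl p ≃+* ℂ) (σ : FramedGaloisRep K (PadicAlgCl p) 2), (∃ (hcpt : isCompact_glFiniteIntegralLevel 2 K) (π : CuspidalAutomorphicRepData 2 K hcpt), (∃ T : InfinityType K 2, π.1.HasInfinityType T ∧ ∀ τ : K →+* ℂ, ∀ x ∈ T τ, x.a = 0 ∧ x.b = 0) ∧ ∀ᶠ w : HeightOneSpectrum (𝓞 K) in Filter.cofinite, ∃ α : Multiset ℂ, π.1.HasSatakeParamAt w α ∧ (σ.HasFrobCharpolyAt w (arithFrobPolyOfSatake ι w.residueCard 1 α) ∨ σ.HasFrobCharpolyAt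 w ((arithFrobPolyOfSatake ι w.residueCard 1 α).comp (-X)))) → (∃ (hcpt : isCompact_glFiniteIntegralLevel 2 K) (π : CuspidalAutomorphicRepData 2 K hcpt), (∃ T : InfinityType K 2, π.1.HasInfinityType T ∧ ∀ τ : K →+* ℂ, ∀ x ∈ T τ, x.a = 0 ∧ x.b = 0) ∧ ∀ᶠ w : HeightOneSpectrum (𝓞 K) in Filter.cofinite, ∃ α : Multiset ℂ, π.1.HasSatakeParamAt w α ∧ ∃ c : ℂ, c ≠ 0 ∧ σ.HasFrobCharpolyAt w (arithFrobPolyOfSatake ι w.residueCard 1 (α.map (c * ·)))) := by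
  intro K _ _ p _ ι σ h
  obtain ⟨hcpt, π, hAT, hπ⟩ := h
  refine ⟨hcpt, π, hAT, hπ.mono fun w hw => ?_⟩
  obtain ⟨α, hα, hor⟩ := hw
  rcases hor with h1 | h1
  · refine ⟨α, hα, 1, one_ne_zero, ?_⟩
    have : α.map ((1 : ℂ) * ·) = α := by simp
    rw [this]
    exact h1
  · refine ⟨α, hα, -1, by norm_num, ?_⟩
    rw [← arithFrobPolyOfSatake_comp_neg_X ι w.residueCard α hα.card_eq]
    exact h1

end Summit.Langlands.Langlands.Theorems.ArtinWeightRealisationEven
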